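import Summits.NavierStokesRegularity.NavierStokesRegularity.Theorems.LerayQuarterDissipationFiniteDissipationLiouvilleReturnTimes
import HarnessLib

/-!
# Crux `FiniteDissipationLiouville` (stmt-NavierStokesRegularity-22144): return times of the
# scaling orbit, II — the log-scale floor and the SHARP small-lag form (the displacement grows at
# least linearly in the lag)

Theorems file of route `LerayQuarterDissipation` (lead prover g13; `--supports` the crux; sequel
of `…ReturnTimes`). Navier–Stokes regularity is NOT proved by anything here; no summit is.

* `logReturnTime_floor_of_singular` — the no-short-return floor of `…ReturnTimes` in the
  log-scale variable of the route's recurrence clause: `‖e^σ W(e^{2σ}s, e^σ y) − W(s,y)‖ > δ`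
  somewhere on every window, for every singular member of `𝒟_{C,K}` and every lag
  `σ ∈ [σ₁, σ₂] ⊂ (0, σ₀)`, `σ₀ = log λ₀(C,K)`.
* `approxDss_pow` — iterating an approximate return: a `μ`-displacement `≤ η` on the dilated window
  `[−(μ₂R)², −(μ₂R)⁻²] × B̄(0,μ₂R)` gives a `μ^k`-displacement `≤ k μ₂ η` on
  `[−R², −R⁻²] × B̄(0,R)` as long as `μ^k ≤ μ₂` (telescoping along the orbit).
* `almostReturn_leaf_log` — **SHARP SMALL-LAG FORM**: there is `κ = κ(C,K,μ₂,R) > 0` such that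
  `‖μ W(μ²s, μy) − W(s,y)‖ ≤ κ log μ` on the dilated window for SOME `1 < μ ≤ μ₂ < λ₀` forces
  regularity (`μ^k` lands in `[√μ₂, μ₂]` at cost `k μ₂ κ log μ ≤ μ₂ κ log μ₂ = δ/2`, uniformly as
  `μ → 1⁺`).
* `displacement_floor_of_singular`, `logDisplacement_floor_of_singular` — PORTRAIT: along every
  finite-dissipation Type-I singularity the scaling displacement grows at least LINEARLY in the
  lag, `sup_window ‖W_{e^σ} − W‖ > κ σ` for `0 < σ ≤ σ₂` — the integrated, every-window form of
  the Pineau–Vicol unsteadiness floor (`…EnvelopePV`: infinitesimal, on `B(0,1)` at late times),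
  joined continuously to the no-short-return floor at lags of order one.
* `finiteDissipationLiouville_iff_noShortReturns` — bookkeeping: the crux ⟺ its restriction to
  members carrying the return-time floor.

HONEST FRAMING: constants from compactness; nothing for lags `≥ log λ₀(C,K)`; crux FRONTIER
(blocked on `∀ c > 1, TypeIDSSLiouville c`).

References: Koch–Nadirashvili–Seregin–Šverák, Acta Math. 203 (2009), §4; Chae–Wolf,
arXiv:1610.09464, Thm 1.3; Pineau–Vicol 2026.
-/

noncomputable section

-- the summit and its single sub-problem share the name (CONVENTIONS §1), as in every Theorems file
set_option linter.dupNamespace false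

namespace Summit.NavierStokesRegularity.NavierStokesRegularity.Theorems.FiniteDissipationLiouville.ReturnTimes

open MeasureTheory Set Filter Topology Metric Function
open Literature.Analysis Literature.Analysis.FluidPDE
open Summit.NavierStokesRegularity.NavierStokesRegularity.Theorems.FiniteDissipationLiouville
open Summit.NavierStokesRegularity.NavierStokesRegularity.Theorems.FiniteDissipationLiouville.Birth
open scoped ENNReal NNReal

/-! ### The log-scale floor -/

/-- **The return-time spectrum of a finite-dissipation Type-I singularity is bounded below**, in
the log-scale variable of the route's recurrence clause: there is `σ₀ = σ₀(C,K) > 0` such that for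
`0 < σ₁ ≤ σ₂ < σ₀` and every window `R > 1` some `δ > 0` bounds from below, for EVERY singular
member of `𝒟_{C,K}` and every lag `σ ∈ [σ₁, σ₂]`, the displacement
`‖e^σ W(e^{2σ}s, e^σ y) − W(s,y)‖` somewhere on `[−R², −R⁻²] × B̄(0,R)`. (A critical element
returns within every `ε` of itself on every window — but never at a lag in `[σ₁, σ₂]` once
`ε < δ`.) -/
theorem logReturnTime_floor_of_singular (C K : ℝ) : ∃ σ₀ : ℝ, 0 < σ₀ ∧
    ∀ σ₁ σ₂ : ℝ, 0 < σ₁ → σ₁ ≤ σ₂ → σ₂ < σ₀ → ∀ R : ℝ, 1 < R → ∃ δ : ℝ, 0 < δ ∧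
      ∀ (W : ℝ → EuclideanSpace ℝ (Fin 3) → EuclideanSpace ℝ (Fin 3)),
        IsTypeIAncientMild C W →
        (∀ s : ℝ, s < 0 → ∫⁻ x, ‖fderiv ℝ (W s) x‖ₑ ^ 2 ≤ ENNReal.ofReal (K / Real.sqrt (-s))) →
        (∀ r > 0, ∀ M : ℝ, ∃ t ∈ Set.Ioo (-(r ^ 2)) (0 : ℝ),
            ∃ x ∈ Metric.ball (0 : EuclideanSpace ℝ (Fin 3)) r, M < ‖W t x‖) →
        ∀ σ ∈ Icc σ₁ σ₂, ∃ s ∈ Icc (-(R ^ 2)) (-(R⁻¹) ^ 2),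
          ∃ y ∈ closedBall (0 : EuclideanSpace ℝ (Fin 3)) R,
            δ < ‖Real.exp σ • W (Real.exp (2 * σ) * s) (Real.exp σ • y) - W s y‖ := by
  obtain ⟨lam₀, h1, h⟩ := returnTime_floor_of_singular C K
  refine ⟨Real.log lam₀, Real.log_pos h1, fun σ₁ σ₂ hσ₁ hσ12 hσ₂ R hR => ?_⟩
  have hμ₁ : 1 < Real.exp σ₁ := by
    rw [← Real.exp_zero]
    exact Real.exp_lt_exp.2 hσ₁
  have hμ12 : Real.exp σ₁ ≤ Real.exp σ₂ := Real.exp_le_exp.2 hσ12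
  have hμ₂ : Real.exp σ₂ < lam₀ := by
    have := Real.exp_lt_exp.2 hσ₂
    rwa [Real.exp_log (one_pos.trans h1)] at this
  obtain ⟨δ, hδ, hfl⟩ := h (Real.exp σ₁) (Real.exp σ₂) hμ₁ hμ12 hμ₂ R hR
  refine ⟨δ, hδ, fun W hW hlaw hsing σ hσ => ?_⟩
  obtain ⟨s, hs, y, hy, hlt⟩ :=
    hfl W hW hlaw hsing (Real.exp σ) ⟨Real.exp_le_exp.2 hσ.1, Real.exp_le_exp.2 hσ.2⟩
  refine ⟨s, hs, y, hy, ?_⟩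
  have e : Real.exp (2 * σ) = Real.exp σ ^ 2 := by
    rw [← Real.exp_nat_mul]
    norm_num
  rwa [e]

/-! ### The sharp small-lag form: the displacement grows at least linearly in the lag -/

/-- **Iterating an approximate return.** If `‖μ W(μ²s, μy) − W(s,y)‖ ≤ η` on the dilated window
`[−(μ₂R)², −(μ₂R)⁻²] × B̄(0, μ₂R)` (`μ, μ₂ ≥ 1`, `R > 0`), then for every `k` with `μ^k ≤ μ₂`
the `μ^k`-displacement on `[−R², −R⁻²] × B̄(0,R)` is at most `k μ₂ η` (telescoping; the
intermediate points stay in the dilated window; `‖μ^j • v‖ = μ^j ‖v‖ ≤ μ₂ ‖v‖`). -/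
theorem approxDss_pow {W : ℝ → EuclideanSpace ℝ (Fin 3) → EuclideanSpace ℝ (Fin 3)}
    {μ μ₂ R η : ℝ} (hμ : 1 ≤ μ) (hμ₂ : 1 ≤ μ₂) (hR : 0 < R)
    (hdef : ∀ s ∈ Icc (-((μ₂ * R) ^ 2)) (-((μ₂ * R)⁻¹) ^ 2),
      ∀ y ∈ closedBall (0 : EuclideanSpace ℝ (Fin 3)) (μ₂ * R),
        ‖μ • W (μ ^ 2 * s) (μ • y) - W s y‖ ≤ η) :
    ∀ k : ℕ, μ ^ k ≤ μ₂ → ∀ s ∈ Icc (-(R ^ 2)) (-(R⁻¹) ^ 2),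
      ∀ y ∈ closedBall (0 : EuclideanSpace ℝ (Fin 3)) R,
        ‖μ ^ k • W ((μ ^ k) ^ 2 * s) (μ ^ k • y) - W s y‖ ≤ k * (μ₂ * η) := by
  have hμ0 : 0 < μ := one_pos.trans_le hμ
  intro k
  induction k with
  | zero =>
    intro _ s _ y _
    simp
  | succ k ih =>
    intro hk s hs y hy
    have hμk1 : 1 ≤ μ ^ k := one_le_pow₀ hμ
    have hμk : μ ^ k ≤ μ₂ := by
      have : μ ^ k ≤ μ ^ (k + 1) := by
        rw [pow_succ]
        exact le_mul_of_one_le_right (by positivity) hμ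
      exact this.trans hk
    have hs0 : s < 0 := by
      have : 0 < (R⁻¹) ^ 2 := by positivity
      linarith [hs.2]
    -- the intermediate point `((μ^k)² s, μ^k y)` lies in the dilated window
    have hs' : (μ ^ k) ^ 2 * s ∈ Icc (-((μ₂ * R) ^ 2)) (-((μ₂ * R)⁻¹) ^ 2) := by
      constructor
      · -- `(μ^k)² s ≥ (μ^k)² (−R²) ≥ μ₂² (−R²)`
        have h1 : (μ ^ k) ^ 2 ≤ μ₂ ^ 2 := pow_le_pow_left₀ (by positivity) hμk 2
        nlinarith [hs.1, sq_nonneg R, sq_nonneg (μ ^ k)]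
      · -- `(μ^k)² s ≤ s ≤ −R⁻² ≤ −(μ₂R)⁻²`
        have h1 : (μ ^ k) ^ 2 * s ≤ 1 * s := by
          have : 1 ≤ (μ ^ k) ^ 2 := one_le_pow₀ hμk1
          nlinarith
        have h2 : ((μ₂ * R)⁻¹) ^ 2 ≤ (R⁻¹) ^ 2 := by
          have hμR : R ≤ μ₂ * R := le_mul_of_one_le_left hR.le hμ₂
          have : (μ₂ * R)⁻¹ ≤ R⁻¹ := inv_anti₀ hR hμR
          exact pow_le_pow_left₀ (by positivity) this 2
        linarith [hs.2]
    have hy' : μ ^ k • y ∈ closedBall (0 : EuclideanSpace ℝ (Fin 3)) (μ₂ * R) := by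
      rw [mem_closedBall, dist_zero_right, norm_smul, Real.norm_of_nonneg (by positivity)]
      rw [mem_closedBall, dist_zero_right] at hy
      exact mul_le_mul hμk hy (norm_nonneg _) (by positivity)
    -- telescoping
    have e1 : (μ ^ (k + 1)) ^ 2 * s = μ ^ 2 * ((μ ^ k) ^ 2 * s) := by ring
    have e2 : μ ^ (k + 1) • y = μ • (μ ^ k • y) := by rw [pow_succ, mul_comm, mul_smul]
    have e3 : μ ^ (k + 1) • W ((μ ^ (k + 1)) ^ 2 * s) (μ ^ (k + 1) • y) =
        μ ^ k • (μ • W (μ ^ 2 * ((μ ^ k) ^ 2 * s)) (μ • (μ ^ k • y))) := by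
      rw [e1, e2, pow_succ, mul_smul]
    have hstep : ‖μ ^ (k + 1) • W ((μ ^ (k + 1)) ^ 2 * s) (μ ^ (k + 1) • y) -
        μ ^ k • W ((μ ^ k) ^ 2 * s) (μ ^ k • y)‖ ≤ μ₂ * η := by
      rw [e3, ← smul_sub, norm_smul, Real.norm_of_nonneg (by positivity)]
      exact mul_le_mul hμk (hdef _ hs' _ hy') (norm_nonneg _) (by positivity)
    calc ‖μ ^ (k + 1) • W ((μ ^ (k + 1)) ^ 2 * s) (μ ^ (k + 1) • y) - W s y‖
        ≤ ‖μ ^ (k + 1) • W ((μ ^ (k + 1)) ^ 2 * s) (μ ^ (k + 1) • y) -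
            μ ^ k • W ((μ ^ k) ^ 2 * s) (μ ^ k • y)‖ +
          ‖μ ^ k • W ((μ ^ k) ^ 2 * s) (μ ^ k • y) - W s y‖ := norm_sub_le_norm_sub_add_norm_sub _ _ _
      _ ≤ μ₂ * η + k * (μ₂ * η) := add_le_add hstep (ih hμk s hs y hy)
      _ = ((k + 1 : ℕ) : ℝ) * (μ₂ * η) := by push_cast; ring

/-- **SHARP SMALL-LAG FORM: `‖W_μ − W‖ ≤ κ log μ` on one window, for one `1 < μ ≤ μ₂ < λ₀`,
forces regularity.** For all `C, K` there is `λ₀ > 1` such that for every `1 < μ₂ < λ₀` and every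
`R > 1` there is `κ = κ(C,K,μ₂,R) > 0` with: a member of `𝒟_{C,K}` satisfying
`‖μ W(μ²s, μy) − W(s,y)‖ ≤ κ log μ` on `[−(μ₂R)², −(μ₂R)⁻²] × B̄(0, μ₂R)` for SOME `μ ∈ (1, μ₂]`
is not singular. (Iterate the return `k` times with `μ^k ∈ [√μ₂, μ₂]`: the cost `k μ₂ κ log μ ≤
μ₂ κ log μ₂ = δ/2` is uniform as `μ → 1⁺` because `k log μ ≤ log μ₂`; then `almostReturn_leaf`
on `[√μ₂, μ₂]`.) -/
theorem almostReturn_leaf_log (C K : ℝ) : ∃ lam₀ : ℝ, 1 < lam₀ ∧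
    ∀ μ₂ : ℝ, 1 < μ₂ → μ₂ < lam₀ → ∀ R : ℝ, 1 < R → ∃ κ : ℝ, 0 < κ ∧
      ∀ (W : ℝ → EuclideanSpace ℝ (Fin 3) → EuclideanSpace ℝ (Fin 3)),
        IsTypeIAncientMild C W →
        (∀ s : ℝ, s < 0 → ∫⁻ x, ‖fderiv ℝ (W s) x‖ₑ ^ 2 ≤ ENNReal.ofReal (K / Real.sqrt (-s))) →
        ∀ μ : ℝ, 1 < μ → μ ≤ μ₂ →
        (∀ s ∈ Icc (-((μ₂ * R) ^ 2)) (-((μ₂ * R)⁻¹) ^ 2),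
          ∀ y ∈ closedBall (0 : EuclideanSpace ℝ (Fin 3)) (μ₂ * R),
            ‖μ • W (μ ^ 2 * s) (μ • y) - W s y‖ ≤ κ * Real.log μ) →
        ¬ (∀ r > 0, ∀ M : ℝ, ∃ t ∈ Set.Ioo (-(r ^ 2)) (0 : ℝ),
            ∃ x ∈ Metric.ball (0 : EuclideanSpace ℝ (Fin 3)) r, M < ‖W t x‖) := by
  obtain ⟨lam₀, h1, h⟩ := almostReturn_leaf C K
  refine ⟨lam₀, h1, fun μ₂ hμ₂ hμ₂l R hR => ?_⟩
  -- the compact factor range `[√μ₂, μ₂]`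
  have hsq1 : 1 < Real.sqrt μ₂ := by
    rw [show (1 : ℝ) = Real.sqrt 1 by simp]
    exact Real.sqrt_lt_sqrt (by norm_num) hμ₂
  have hsq0 : 0 < Real.sqrt μ₂ := one_pos.trans hsq1
  have hsqsq : Real.sqrt μ₂ * Real.sqrt μ₂ = μ₂ := Real.mul_self_sqrt (zero_le_one.trans hμ₂.le)
  have hsqle : Real.sqrt μ₂ ≤ μ₂ := by nlinarith
  obtain ⟨δ, hδ, hreg⟩ := h (Real.sqrt μ₂) μ₂ hsq1 hsqle hμ₂l R hR
  have hlog2 : 0 < Real.log μ₂ := Real.log_pos hμ₂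
  have hμ₂0 : 0 < μ₂ := one_pos.trans hμ₂
  set κ : ℝ := δ / (2 * μ₂ * Real.log μ₂) with hκ
  have hκ0 : 0 < κ := by positivity
  have hκid : μ₂ * κ * Real.log μ₂ = δ / 2 := by
    rw [hκ]; field_simp
  refine ⟨κ, hκ0, fun W hW hlaw μ hμ1 hμle hdef hsing => ?_⟩
  have hμ0 : 0 < μ := one_pos.trans hμ1
  have hlogμ : 0 < Real.log μ := Real.log_pos hμ1
  -- ### an exponent `k ≥ 1` with `μ^k ∈ [√μ₂, μ₂]` and `k log μ ≤ log μ₂`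
  obtain ⟨k, hk1, hk2, hk3⟩ : ∃ k : ℕ, Real.sqrt μ₂ ≤ μ ^ k ∧ μ ^ k ≤ μ₂ ∧
      (k : ℝ) * Real.log μ ≤ Real.log μ₂ := by
    rcases le_or_gt μ (Real.sqrt μ₂) with hle | hgt
    · obtain ⟨n, hn1, hn2⟩ := exists_nat_pow_near hsq1.le hμ1
      refine ⟨n + 1, hn2.le, ?_, ?_⟩
      · rw [pow_succ]
        calc μ ^ n * μ ≤ Real.sqrt μ₂ * Real.sqrt μ₂ :=
              mul_le_mul hn1 hle hμ0.le hsq0.le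
          _ = μ₂ := hsqsq
      · have hnlog : (n : ℝ) * Real.log μ ≤ Real.log μ₂ / 2 := by
          rw [← Real.log_pow, ← Real.log_sqrt hμ₂0.le]
          exact Real.log_le_log (by positivity) hn1
        have hμlog : Real.log μ ≤ Real.log μ₂ / 2 := by
          rw [← Real.log_sqrt hμ₂0.le]
          exact Real.log_le_log hμ0 hle
        push_cast
        linarith
    · refine ⟨1, ?_, ?_, ?_⟩
      · rw [pow_one]; exact hgt.le
      · rw [pow_one]; exact hμle
      · push_cast
        rw [one_mul]
        exact Real.log_le_log hμ0 hμle
  -- ### the iterated return has window defect `≤ k μ₂ κ log μ ≤ δ/2 ≤ δ`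
  have hpow := approxDss_pow (W := W) hμ1.le hμ₂.le (zero_lt_one.trans hR) hdef k hk2
  have hbound : ∀ s ∈ Icc (-(R ^ 2)) (-(R⁻¹) ^ 2),
      ∀ y ∈ closedBall (0 : EuclideanSpace ℝ (Fin 3)) R,
        ‖μ ^ k • W ((μ ^ k) ^ 2 * s) (μ ^ k • y) - W s y‖ ≤ δ := by
    intro s hs y hy
    refine (hpow s hs y hy).trans ?_
    have : (k : ℝ) * (μ₂ * (κ * Real.log μ)) = μ₂ * κ * ((k : ℝ) * Real.log μ) := by ring
    rw [this]
    calc μ₂ * κ * ((k : ℝ) * Real.log μ) ≤ μ₂ * κ * Real.log μ₂ :=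
          mul_le_mul_of_nonneg_left hk3 (by positivity)
      _ = δ / 2 := hκid
      _ ≤ δ := by linarith
  exact hreg W hW hlaw (μ ^ k) ⟨hk1, hk2⟩ hbound hsing

/-- **PORTRAIT: along every finite-dissipation Type-I singularity the scaling displacement grows
at least LINEARLY in the lag.** For every singular member of `𝒟_{C,K}`, every `1 < μ ≤ μ₂ < λ₀`
and every window: `‖μ W(μ²s, μy) − W(s,y)‖ > κ(C,K,μ₂,R) · log μ` somewhere on
`[−(μ₂R)², −(μ₂R)⁻²] × B̄(0, μ₂R)` — the integrated, every-window form of the Pineau–Vicol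
unsteadiness floor (`…EnvelopePV`: the infinitesimal generator on `B(0,1)` at late times), joined
continuously to the no-short-return floor at lags of order one. -/
theorem displacement_floor_of_singular (C K : ℝ) : ∃ lam₀ : ℝ, 1 < lam₀ ∧
    ∀ μ₂ : ℝ, 1 < μ₂ → μ₂ < lam₀ → ∀ R : ℝ, 1 < R → ∃ κ : ℝ, 0 < κ ∧
      ∀ (W : ℝ → EuclideanSpace ℝ (Fin 3) → EuclideanSpace ℝ (Fin 3)),
        IsTypeIAncientMild C W →
        (∀ s : ℝ, s < 0 → ∫⁻ x, ‖fderiv ℝ (W s) x‖ₑ ^ 2 ≤ ENNReal.ofReal (K / Real.sqrt (-s))) →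
        (∀ r > 0, ∀ M : ℝ, ∃ t ∈ Set.Ioo (-(r ^ 2)) (0 : ℝ),
            ∃ x ∈ Metric.ball (0 : EuclideanSpace ℝ (Fin 3)) r, M < ‖W t x‖) →
        ∀ μ : ℝ, 1 < μ → μ ≤ μ₂ →
          ∃ s ∈ Icc (-((μ₂ * R) ^ 2)) (-((μ₂ * R)⁻¹) ^ 2),
            ∃ y ∈ closedBall (0 : EuclideanSpace ℝ (Fin 3)) (μ₂ * R),
              κ * Real.log μ < ‖μ • W (μ ^ 2 * s) (μ • y) - W s y‖ := by
  obtain ⟨lam₀, h1, h⟩ := almostReturn_leaf_log C K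
  refine ⟨lam₀, h1, fun μ₂ hμ₂ hμ₂l R hR => ?_⟩
  obtain ⟨κ, hκ, hreg⟩ := h μ₂ hμ₂ hμ₂l R hR
  refine ⟨κ, hκ, fun W hW hlaw hsing μ hμ1 hμle => ?_⟩
  by_contra hcon
  push Not at hcon
  exact hreg W hW hlaw μ hμ1 hμle hcon hsing

/-- The same in the log-scale variable: `‖e^σ W(e^{2σ}s, e^σ y) − W(s,y)‖ > κ σ` somewhere on the
window `[−(e^{σ₂}R)², −(e^{σ₂}R)⁻²] × B̄(0, e^{σ₂}R)`, for every `0 < σ ≤ σ₂ < σ₀(C,K)`. -/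
theorem logDisplacement_floor_of_singular (C K : ℝ) : ∃ σ₀ : ℝ, 0 < σ₀ ∧
    ∀ σ₂ : ℝ, 0 < σ₂ → σ₂ < σ₀ → ∀ R : ℝ, 1 < R → ∃ κ : ℝ, 0 < κ ∧
      ∀ (W : ℝ → EuclideanSpace ℝ (Fin 3) → EuclideanSpace ℝ (Fin 3)),
        IsTypeIAncientMild C W →
        (∀ s : ℝ, s < 0 → ∫⁻ x, ‖fderiv ℝ (W s) x‖ₑ ^ 2 ≤ ENNReal.ofReal (K / Real.sqrt (-s))) →
        (∀ r > 0, ∀ M : ℝ, ∃ t ∈ Set.Ioo (-(r ^ 2)) (0 : ℝ),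
            ∃ x ∈ Metric.ball (0 : EuclideanSpace ℝ (Fin 3)) r, M < ‖W t x‖) →
        ∀ σ : ℝ, 0 < σ → σ ≤ σ₂ →
          ∃ s ∈ Icc (-((Real.exp σ₂ * R) ^ 2)) (-((Real.exp σ₂ * R)⁻¹) ^ 2),
            ∃ y ∈ closedBall (0 : EuclideanSpace ℝ (Fin 3)) (Real.exp σ₂ * R),
              κ * σ < ‖Real.exp σ • W (Real.exp (2 * σ) * s) (Real.exp σ • y) - W s y‖ := by
  obtain ⟨lam₀, h1, h⟩ := displacement_floor_of_singular C K
  refine ⟨Real.log lam₀, Real.log_pos h1, fun σ₂ hσ₂ hσ₂l R hR => ?_⟩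
  have hμ₂ : 1 < Real.exp σ₂ := by
    rw [← Real.exp_zero]
    exact Real.exp_lt_exp.2 hσ₂
  have hμ₂l : Real.exp σ₂ < lam₀ := by
    have := Real.exp_lt_exp.2 hσ₂l
    rwa [Real.exp_log (one_pos.trans h1)] at this
  obtain ⟨κ, hκ, hfl⟩ := h (Real.exp σ₂) hμ₂ hμ₂l R hR
  refine ⟨κ, hκ, fun W hW hlaw hsing σ hσ hσle => ?_⟩
  have hμ1 : 1 < Real.exp σ := by
    rw [← Real.exp_zero]
    exact Real.exp_lt_exp.2 hσ
  obtain ⟨s, hs, y, hy, hlt⟩ := hfl W hW hlaw hsing (Real.exp σ) hμ1 (Real.exp_le_exp.2 hσle)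
  refine ⟨s, hs, y, hy, ?_⟩
  have e : Real.exp (2 * σ) = Real.exp σ ^ 2 := by
    rw [← Real.exp_nat_mul]
    norm_num
  rw [e]
  rwa [Real.log_exp] at hlt


/-! ### Bookkeeping -/

/-- **The crux ⟺ its restriction to members carrying the return-time floor**: singular members
carry it (`returnTime_floor_of_singular`), so assuming it costs nothing. -/
theorem finiteDissipationLiouville_iff_noShortReturns :
    Theses.LerayQuarterDissipation.FiniteDissipationLiouville ↔
    ∀ (C K : ℝ) (W : ℝ → EuclideanSpace ℝ (Fin 3) → EuclideanSpace ℝ (Fin 3)),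
      IsTypeIAncientMild C W →
      (∀ s : ℝ, s < 0 → ∫⁻ x, ‖fderiv ℝ (W s) x‖ₑ ^ 2 ≤ ENNReal.ofReal (K / Real.sqrt (-s))) →
      -- the return-time floor of this file, as carried by singular members
      (∃ lam₀ : ℝ, 1 < lam₀ ∧ ∀ μ₁ μ₂ : ℝ, 1 < μ₁ → μ₁ ≤ μ₂ → μ₂ < lam₀ → ∀ R : ℝ, 1 < R →
        ∃ δ : ℝ, 0 < δ ∧ ∀ μ ∈ Icc μ₁ μ₂, ∃ s ∈ Icc (-(R ^ 2)) (-(R⁻¹) ^ 2),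
          ∃ y ∈ closedBall (0 : EuclideanSpace ℝ (Fin 3)) R,
            δ < ‖μ • W (μ ^ 2 * s) (μ • y) - W s y‖) →
      ¬ (∀ r > 0, ∀ M : ℝ, ∃ t ∈ Set.Ioo (-(r ^ 2)) (0 : ℝ),
          ∃ x ∈ Metric.ball (0 : EuclideanSpace ℝ (Fin 3)) r, M < ‖W t x‖) := by
  constructor
  · intro hL C K W hW hlaw _
    exact hL C K W hW hlaw
  · intro h C K W hW hlaw hsing
    obtain ⟨lam₀, h1, hfl⟩ := returnTime_floor_of_singular C K
    refine h C K W hW hlaw ⟨lam₀, h1, fun μ₁ μ₂ hμ₁ hμ12 hμ₂ R hR => ?_⟩ hsing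
    obtain ⟨δ, hδ, hδfl⟩ := hfl μ₁ μ₂ hμ₁ hμ12 hμ₂ R hR
    exact ⟨δ, hδ, fun μ hμ => hδfl W hW hlaw hsing μ hμ⟩

end Summit.NavierStokesRegularity.NavierStokesRegularity.Theorems.FiniteDissipationLiouville.ReturnTimes

end
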